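import Summits.QuantumFields.YangMills.Theorems.ColdStartUniversalityLatticeLangevinMacroscopicMixingOfLogSobolev
import Summits.QuantumFields.YangMills.Theorems.ColdStartUniversalityUniformColdStartMixingFixedCutoffMacroscopicWindow
import HarnessLib

/-!
# Route `ColdStartUniversality`, aside K_A1 `UniformColdStartMixing` (24809), LINE 4 «cold_entropy»: (ULS) ALONE ⇒ NEAR-UNIFORM (logarithmic in
# the cut-off) COLD-START EQUILIBRATION OF SPATIALLY AVERAGED WILSON LOOPS — the K-uniform entropy-budget stub bypassed up to `log(1/ε_K)`

Helper file (seat `ym-line-csu-p1`, g28; `--supports stmt-QuantumFields-24809`).  LINE 4 composes the crux from TWO K-uniform open hypotheses,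
(ULS) «`∃γ₁ ∀F γ ∃c>0 ∃K₀ ∀K≥K₀ ∀C³ f: c·ε_K·Ent_(μ_K)(F²) ≤ −∫F·𝓛_K f dμ_K`» and the entropy budget `stub_coldEntropyBudget` (a K-UNIFORM bound on
`KL(law U_(s₀/ε_K) ‖ μ_K)` at a positive PHYSICAL time `s₀` — a multiscale/UV statement: at a fixed LATTICE time the relative entropy is extensive,
`B_K = O(β'_K L_K³)`, and K-uniformity at fixed `s₀ > 0` is exactly the assertion that the UV modes have equilibrated in UV time (free-field count:
`KL ≈ ℓ³(2γ)^(3/2) s₀^(−3/2)`; ERRATUM to the first landed version of this docstring, which called the stub «implausible as typed» — that referred to a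
lattice-time reading and is withdrawn).  The transport–entropy route needs only the PRODUCT (carré bound) × (entropy budget), and for a spatial average
the carré bound `O(1/L_K³)` cancels the extensivity of the TRIVIAL explicit lattice-time budget `B_K` (g27), leaving `O(β'_K) = O(1/(γε_K))`:
* ★★★ `nearUniform_wilsonLoop_coldStart_of_uniformLogSobolev` — (ULS) ⇒ `∃γ₁>0 ∀F, 0<γ≤γ₁ ⇒ ∃c>0 ∃K₀ ∀K≥K₀`, for every `R×T` loop (`R+T>0`), every
  solution of the SZZ dynamics at `β'_K` from any deterministic start and every lattice time `u ≥ 0`: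
  `|E W̄(U_(2+u)) − ∫W̄ dμ_K| ≤ e^(−2cε_K·u) · (R+T)·√(48(366β'_K + 3)/(cε_K))` (`W̄ = (L_K³)⁻¹Σ_x W_(R×T)(x; i, j)`);
* ★★★ `nearUniform_wilsonLoop_physicalTime_of_uniformLogSobolev` — in the crux's physical time `s = ε_K t`: for every `δ > 0` and every
  `s ≥ 2ε_K + log((R+T)√(48(366β'_K + 3)/(cε_K))/δ)/(2c)` (and `s ≥ 2ε_K`): `|E W̄(U(s/ε_K)) − ∫W̄ dμ_K| ≤ δ`, POINTWISE in time;
* ★ `nearUniform_threshold_le_log` — for `ε_K ≤ 1`, `γε_K ≤ 1` that threshold is at most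
  `2 + (log((R+T)/δ) + ½log(8928/(γc)))/(2c) + log(1/ε_K)/(2c)`: the ONLY cut-off dependence is `log(1/ε_K)/(2c)`.
So, for torus-averaged Wilson loops, (ULS) alone gives the conclusion of K_A1 up to a `log(1/ε_K)` in the time threshold (and pointwise rather than
Cesàro).  PLANNER-FACING, HONEST: (ULS) is K-UNIFORM and OPEN (in the tree only its fixed-cut-off rungs: `(1−6/(γε_K))/2` in the window `γε_K > 6`,
Holley–Stroock `½e^(−4β'_K#𝒫_K)` everywhere); the observables are torus-wide averages of `Re tr`-Wilson loops, not the crux's block averages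
`avgObs expMeanLogSU` (piecewise, not `C³`); the residual `log(1/ε_K)` comes from the explicit budget's `β'_K` and would disappear only with a budget
`KL(law U_(t₀ε_K⁻¹) ‖ μ_K) = o(β'_K L_K³)·…` at positive physical time — itself a UV statement; nothing K-uniform is proved; 24809 is ASIDE and NOT
restated; no crux, rung or summit statement is proved; the Yang–Mills mass gap is NOT proved.  THEOREMS ONLY, no definition, no sorry.
[cite: BakryGentilLedoux2014, Thm 5.2.1]
-/

set_option autoImplicit false

noncomputable section

namespace Summit.QuantumFields.YangMills.Theorems.ColdStartUniversality

open MeasureTheory ProbabilityTheory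
open scoped NNReal ENNReal BigOperators
open Literature.Probability.Process Literature.MathematicalPhysics.QuantumFieldTheory
open Literature.MathematicalPhysics.QuantumLattice (fundamentalRep fundamentalLatticeRep continuous_fundamentalRep)
open Literature.MathematicalPhysics.QuantumFieldTheory.Balaban1983to89

/-! ## §1. (ULS) ⇒ near-uniform equilibration of averaged Wilson loops, lattice time -/

/-- ★★★ **(ULS) alone ⇒ cold-start equilibration of spatially averaged Wilson loops with an `O(ε_K⁻¹)` prefactor and physical rate `2c`.**
Under the route's K-uniform log-Sobolev hypothesis (ULS): there is `γ₁ > 0` such that for every admissible family `F` and `0 < γ ≤ γ₁` there are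
`c > 0` and `K₀` with: for all `K ≥ K₀`, all `R × T` loops (`R + T > 0`, directions `i, j`), every solution of the SZZ dynamics at `β'_K = (γε_K)⁻¹/2`
from any deterministic start on any probability space, and every lattice time `u ≥ 0`,
`|E W̄(U_(2+u)) − ∫ W̄ dμ_K| ≤ e^(−2cε_K u) · (R+T) · √(48(366β'_K + 3)/(cε_K))`. [cite: BakryGentilLedoux2014, Thm 5.2.1] -/
theorem nearUniform_wilsonLoop_coldStart_of_uniformLogSobolev
    (hULS : ∃ γ₁ : ℝ, 0 < γ₁ ∧ ∀ (F : T3ContinuumYM3Torus.T3Family) (γ : ℝ), 0 < γ → γ ≤ γ₁ →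
      ∃ c : ℝ, 0 < c ∧ ∃ K₀ : ℕ, ∀ K : ℕ, K₀ ≤ K →
        ∀ (f : (Edge 3 ((F.P K).sitesPerDir 0) × Fin 2 × Fin 2 × Bool → ℝ) → ℝ), ContDiff ℝ 3 f →
        let coords : GaugeConfig 3 ((F.P K).sitesPerDir 0) (Matrix.specialUnitaryGroup (Fin 2) ℂ) →
            (Edge 3 ((F.P K).sitesPerDir 0) × Fin 2 × Fin 2 × Bool → ℝ) :=
          fun V q => (fun z : ℂ => if q.2.2.2 then z.im else z.re)
            ((fundamentalRep (Fin 2) (V q.1) : Matrix (Fin 2) (Fin 2) ℂ) q.2.1 q.2.2.1)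
        let gen : GaugeConfig 3 ((F.P K).sitesPerDir 0) (Matrix.specialUnitaryGroup (Fin 2) ℂ) → ℝ := fun V =>
          (∑ i : Edge 3 ((F.P K).sitesPerDir 0) × Fin 2 × Fin 2 × Bool, fderiv ℝ f (coords V) (Pi.single i 1) *
              (fun z : ℂ => if i.2.2.2 then z.im else z.re)
                ((latticeLangevinDynamics (fundamentalLatticeRep 2) ((γ * (F.P K).eps)⁻¹ / 2)).drift
                  (matrixConfig (fundamentalRep (Fin 2)) V) i.1 i.2.1 i.2.2.1) +
          1 / 2 * ∑ i : Edge 3 ((F.P K).sitesPerDir 0) × Fin 2 × Fin 2 × Bool,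
            ∑ j : Edge 3 ((F.P K).sitesPerDir 0) × Fin 2 × Fin 2 × Bool,
            fderiv ℝ (fun z => fderiv ℝ f z (Pi.single i 1)) (coords V) (Pi.single j 1) *
              ∑ n : Edge 3 ((F.P K).sitesPerDir 0) × NoiseIdx 2,
                (if n.1 = i.1 then (fun z : ℂ => if i.2.2.2 then z.im else z.re)
                  ((latticeLangevinDynamics (fundamentalLatticeRep 2) ((γ * (F.P K).eps)⁻¹ / 2)).noise
                    (matrixConfig (fundamentalRep (Fin 2)) V) i.1 n.2 i.2.1 i.2.2.1) else 0) *
                (if n.1 = j.1 then (fun z : ℂ => if j.2.2.2 then z.im else z.re)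
                  ((latticeLangevinDynamics (fundamentalLatticeRep 2) ((γ * (F.P K).eps)⁻¹ / 2)).noise
                    (matrixConfig (fundamentalRep (Fin 2)) V) j.1 n.2 j.2.1 j.2.2.1) else 0))
        c * (F.P K).eps *
            ((∫ V, f (coords V) ^ 2 * Real.log (f (coords V) ^ 2)
                ∂(wilsonMeasure (d := 3) (L := (F.P K).sitesPerDir 0) (fundamentalRep (Fin 2)) ((γ * (F.P K).eps)⁻¹ / 2))) -
              (∫ V, f (coords V) ^ 2
                ∂(wilsonMeasure (d := 3) (L := (F.P K).sitesPerDir 0) (fundamentalRep (Fin 2)) ((γ * (F.P K).eps)⁻¹ / 2))) *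
                Real.log (∫ V, f (coords V) ^ 2
                  ∂(wilsonMeasure (d := 3) (L := (F.P K).sitesPerDir 0) (fundamentalRep (Fin 2)) ((γ * (F.P K).eps)⁻¹ / 2)))) ≤
          -∫ V, f (coords V) * gen V
            ∂(wilsonMeasure (d := 3) (L := (F.P K).sitesPerDir 0) (fundamentalRep (Fin 2)) ((γ * (F.P K).eps)⁻¹ / 2))) :
    ∃ γ₁ : ℝ, 0 < γ₁ ∧ ∀ (F : T3ContinuumYM3Torus.T3Family) (γ : ℝ), 0 < γ → γ ≤ γ₁ →
      ∃ c : ℝ, 0 < c ∧ ∃ K₀ : ℕ, ∀ K : ℕ, K₀ ≤ K →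
        ∀ (i j : Fin 3) (R T : ℕ), 0 < R + T →
        ∀ (z : GaugeConfig 3 ((F.P K).sitesPerDir 0) (Matrix.specialUnitaryGroup (Fin 2) ℂ))
          (Ω : Type) (mΩ : MeasurableSpace Ω) (P : Measure Ω) (hP : IsProbabilityMeasure P)
          (W : ℝ≥0 → Ω → (Edge 3 ((F.P K).sitesPerDir 0) × NoiseIdx 2 → ℝ)) (hW : IsFlatBrownian W P)
          (U : ℝ≥0 → Ω → GaugeConfig 3 ((F.P K).sitesPerDir 0) (Matrix.specialUnitaryGroup (Fin 2) ℂ)),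
          (∀ ω, U 0 ω = z) →
          (latticeLangevinDynamics (fundamentalLatticeRep 2) ((γ * (F.P K).eps)⁻¹ / 2)).IsSolution (fundamentalRep (Fin 2)) hW.natFiltration P W U →
          ∀ u : ℝ≥0,
            |(∫ ω, (((Fintype.card (Site 3 ((F.P K).sitesPerDir 0)) : ℝ))⁻¹ * ∑ x : Site 3 ((F.P K).sitesPerDir 0), wilsonLoop (fundamentalRep (Fin 2)) x i j R T (U ((2 : ℝ≥0) + u) ω)) ∂P) - ∫ V, (((Fintype.card (Site 3 ((F.P K).sitesPerDir 0)) : ℝ))⁻¹ * ∑ x : Site 3 ((F.P K).sitesPerDir 0), wilsonLoop (fundamentalRep (Fin 2)) x i j R T V) ∂(wilsonMeasure (d := 3) (L := ((F.P K).sitesPerDir 0)) (fundamentalRep (Fin 2)) ((γ * (F.P K).eps)⁻¹ / 2))| ≤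
              Real.exp (-(2 * (c * (F.P K).eps)) * u) * (((R : ℝ) + T) * Real.sqrt (48 * (366 * |(γ * (F.P K).eps)⁻¹ / 2| + 3) / (c * (F.P K).eps))) := by
  obtain ⟨γ₁, hγ₁, h⟩ := hULS
  refine ⟨γ₁, hγ₁, fun F γ hγ hγ1 => ?_⟩
  obtain ⟨c, hc, K₀, hK⟩ := h F γ hγ hγ1
  refine ⟨c, hc, K₀, fun K hKK i j R T hRT z Ω mΩ P hP W hW U hU0 hU u => ?_⟩
  have hρ : 0 < c * (F.P K).eps := mul_pos hc (F.P K).eps_pos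
  exact wilson_coldStart_loopAverage_le_coupling_of_logSobolev ((F.P K).sitesPerDir 0) ((γ * (F.P K).eps)⁻¹ / 2) i j hρ R T hRT z (hK K hKK) hW hU0 hU u

/-! ## §2. Physical time: the threshold and its logarithmic cut-off dependence -/

/-- ★★★ **(ULS) ⇒ pointwise-in-physical-time equilibration of averaged Wilson loops with threshold `2ε_K + log(C_K/δ)/(2c)`**,
`C_K = (R+T)√(48(366β'_K + 3)/(cε_K))`: for `s ≥ 2ε_K` and `s ≥ 2ε_K + log(C_K/δ)/(2c)`, `|E W̄(U(s/ε_K)) − ∫W̄ dμ_K| ≤ δ`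
(`U (s/ε_K).toNNReal` as in the crux). [cite: BakryGentilLedoux2014, Thm 5.2.1] -/
theorem nearUniform_wilsonLoop_physicalTime_of_uniformLogSobolev
    (hULS : ∃ γ₁ : ℝ, 0 < γ₁ ∧ ∀ (F : T3ContinuumYM3Torus.T3Family) (γ : ℝ), 0 < γ → γ ≤ γ₁ →
      ∃ c : ℝ, 0 < c ∧ ∃ K₀ : ℕ, ∀ K : ℕ, K₀ ≤ K →
        ∀ (f : (Edge 3 ((F.P K).sitesPerDir 0) × Fin 2 × Fin 2 × Bool → ℝ) → ℝ), ContDiff ℝ 3 f →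
        let coords : GaugeConfig 3 ((F.P K).sitesPerDir 0) (Matrix.specialUnitaryGroup (Fin 2) ℂ) →
            (Edge 3 ((F.P K).sitesPerDir 0) × Fin 2 × Fin 2 × Bool → ℝ) :=
          fun V q => (fun z : ℂ => if q.2.2.2 then z.im else z.re)
            ((fundamentalRep (Fin 2) (V q.1) : Matrix (Fin 2) (Fin 2) ℂ) q.2.1 q.2.2.1)
        let gen : GaugeConfig 3 ((F.P K).sitesPerDir 0) (Matrix.specialUnitaryGroup (Fin 2) ℂ) → ℝ := fun V =>
          (∑ i : Edge 3 ((F.P K).sitesPerDir 0) × Fin 2 × Fin 2 × Bool, fderiv ℝ f (coords V) (Pi.single i 1) *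
              (fun z : ℂ => if i.2.2.2 then z.im else z.re)
                ((latticeLangevinDynamics (fundamentalLatticeRep 2) ((γ * (F.P K).eps)⁻¹ / 2)).drift
                  (matrixConfig (fundamentalRep (Fin 2)) V) i.1 i.2.1 i.2.2.1) +
          1 / 2 * ∑ i : Edge 3 ((F.P K).sitesPerDir 0) × Fin 2 × Fin 2 × Bool,
            ∑ j : Edge 3 ((F.P K).sitesPerDir 0) × Fin 2 × Fin 2 × Bool,
            fderiv ℝ (fun z => fderiv ℝ f z (Pi.single i 1)) (coords V) (Pi.single j 1) *
              ∑ n : Edge 3 ((F.P K).sitesPerDir 0) × NoiseIdx 2,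
                (if n.1 = i.1 then (fun z : ℂ => if i.2.2.2 then z.im else z.re)
                  ((latticeLangevinDynamics (fundamentalLatticeRep 2) ((γ * (F.P K).eps)⁻¹ / 2)).noise
                    (matrixConfig (fundamentalRep (Fin 2)) V) i.1 n.2 i.2.1 i.2.2.1) else 0) *
                (if n.1 = j.1 then (fun z : ℂ => if j.2.2.2 then z.im else z.re)
                  ((latticeLangevinDynamics (fundamentalLatticeRep 2) ((γ * (F.P K).eps)⁻¹ / 2)).noise
                    (matrixConfig (fundamentalRep (Fin 2)) V) j.1 n.2 j.2.1 j.2.2.1) else 0))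
        c * (F.P K).eps *
            ((∫ V, f (coords V) ^ 2 * Real.log (f (coords V) ^ 2)
                ∂(wilsonMeasure (d := 3) (L := (F.P K).sitesPerDir 0) (fundamentalRep (Fin 2)) ((γ * (F.P K).eps)⁻¹ / 2))) -
              (∫ V, f (coords V) ^ 2
                ∂(wilsonMeasure (d := 3) (L := (F.P K).sitesPerDir 0) (fundamentalRep (Fin 2)) ((γ * (F.P K).eps)⁻¹ / 2))) *
                Real.log (∫ V, f (coords V) ^ 2
                  ∂(wilsonMeasure (d := 3) (L := (F.P K).sitesPerDir 0) (fundamentalRep (Fin 2)) ((γ * (F.P K).eps)⁻¹ / 2)))) ≤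
          -∫ V, f (coords V) * gen V
            ∂(wilsonMeasure (d := 3) (L := (F.P K).sitesPerDir 0) (fundamentalRep (Fin 2)) ((γ * (F.P K).eps)⁻¹ / 2))) :
    ∃ γ₁ : ℝ, 0 < γ₁ ∧ ∀ (F : T3ContinuumYM3Torus.T3Family) (γ : ℝ), 0 < γ → γ ≤ γ₁ →
      ∃ c : ℝ, 0 < c ∧ ∃ K₀ : ℕ, ∀ K : ℕ, K₀ ≤ K →
        ∀ (i j : Fin 3) (R T : ℕ), 0 < R + T → ∀ δ : ℝ, 0 < δ →
        ∀ (z : GaugeConfig 3 ((F.P K).sitesPerDir 0) (Matrix.specialUnitaryGroup (Fin 2) ℂ))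
          (Ω : Type) (mΩ : MeasurableSpace Ω) (P : Measure Ω) (hP : IsProbabilityMeasure P)
          (W : ℝ≥0 → Ω → (Edge 3 ((F.P K).sitesPerDir 0) × NoiseIdx 2 → ℝ)) (hW : IsFlatBrownian W P)
          (U : ℝ≥0 → Ω → GaugeConfig 3 ((F.P K).sitesPerDir 0) (Matrix.specialUnitaryGroup (Fin 2) ℂ)),
          (∀ ω, U 0 ω = z) →
          (latticeLangevinDynamics (fundamentalLatticeRep 2) ((γ * (F.P K).eps)⁻¹ / 2)).IsSolution (fundamentalRep (Fin 2)) hW.natFiltration P W U →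
          ∀ s : ℝ, 2 * (F.P K).eps ≤ s →
            2 * (F.P K).eps + Real.log ((((R : ℝ) + T) * Real.sqrt (48 * (366 * |(γ * (F.P K).eps)⁻¹ / 2| + 3) / (c * (F.P K).eps))) / δ) / (2 * c) ≤ s →
            |(∫ ω, (((Fintype.card (Site 3 ((F.P K).sitesPerDir 0)) : ℝ))⁻¹ * ∑ x : Site 3 ((F.P K).sitesPerDir 0), wilsonLoop (fundamentalRep (Fin 2)) x i j R T (U (s / (F.P K).eps).toNNReal ω)) ∂P) - ∫ V, (((Fintype.card (Site 3 ((F.P K).sitesPerDir 0)) : ℝ))⁻¹ * ∑ x : Site 3 ((F.P K).sitesPerDir 0), wilsonLoop (fundamentalRep (Fin 2)) x i j R T V) ∂(wilsonMeasure (d := 3) (L := ((F.P K).sitesPerDir 0)) (fundamentalRep (Fin 2)) ((γ * (F.P K).eps)⁻¹ / 2))| ≤ δ := by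
  obtain ⟨γ₁, hγ₁, h⟩ := nearUniform_wilsonLoop_coldStart_of_uniformLogSobolev hULS
  refine ⟨γ₁, hγ₁, fun F γ hγ hγ1 => ?_⟩
  obtain ⟨c, hc, K₀, hK⟩ := h F γ hγ hγ1
  refine ⟨c, hc, K₀, fun K hKK i j R T hRT δ hδ z Ω mΩ P hP W hW U hU0 hU s h2 hs => ?_⟩
  have he : 0 < (F.P K).eps := (F.P K).eps_pos
  have hRT' : (0 : ℝ) < (R : ℝ) + T := by exact_mod_cast hRT
  have hcε : 0 < c * (F.P K).eps := mul_pos hc he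
  obtain ⟨hsplit, hu⟩ := toNNReal_div_eq_two_add he h2
  rw [hsplit]
  have hb := hK K hKK i j R T hRT z Ω mΩ P hP W hW U hU0 hU (s / (F.P K).eps - 2).toNNReal
  refine hb.trans ?_
  obtain ⟨C, hC⟩ : ∃ C : ℝ, (((R : ℝ) + T) * Real.sqrt (48 * (366 * |(γ * (F.P K).eps)⁻¹ / 2| + 3) / (c * (F.P K).eps))) = C := ⟨_, rfl⟩
  rw [hC] at hs ⊢
  have hCpos : 0 < C := by rw [← hC]; positivity
  -- `e^(−2cε u) = e^(−2c(s − 2ε)) ≤ δ/C`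
  have hu' : Real.log (C / δ) ≤ 2 * c * (s - 2 * (F.P K).eps) := by
    have h1 : Real.log (C / δ) / (2 * c) ≤ s - 2 * (F.P K).eps := by linarith
    rw [div_le_iff₀ (by positivity)] at h1
    linarith
  have hexp : Real.exp (-(2 * (c * (F.P K).eps)) * (((s / (F.P K).eps - 2).toNNReal : ℝ≥0) : ℝ)) ≤ δ / C := by
    rw [hu]
    have e : -(2 * (c * (F.P K).eps)) * (s / (F.P K).eps - 2) = -(2 * c * (s - 2 * (F.P K).eps)) := by
      field_simp
    rw [e]
    have h1 : Real.exp (-(2 * c * (s - 2 * (F.P K).eps))) ≤ Real.exp (-Real.log (C / δ)) := Real.exp_le_exp.2 (by linarith)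
    rw [Real.exp_neg (Real.log (C / δ)), Real.exp_log (div_pos hCpos hδ), inv_div] at h1
    exact h1
  calc Real.exp (-(2 * (c * (F.P K).eps)) * (((s / (F.P K).eps - 2).toNNReal : ℝ≥0) : ℝ)) * C ≤ δ / C * C :=
        mul_le_mul_of_nonneg_right hexp hCpos.le
    _ = δ := div_mul_cancel₀ δ hCpos.ne'

/-- ★ **The threshold is `O(log(1/ε_K))`**: for `0 < ε ≤ 1`, `0 < γ`, `γε ≤ 1`, `c, δ, R+T > 0`,
`2ε + log((R+T)√(48(366·|(γε)⁻¹/2| + 3)/(cε))/δ)/(2c) ≤ 2 + (log((R+T)/δ) + log(8928/(γc))/2)/(2c) + log(1/ε)/(2c)`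
(`366·(γε)⁻¹/2 + 3 = (183 + 3γε)/(γε) ≤ 186/(γε)`, `√(8928/(γcε²)) = √(8928/(γc))/ε`). [folklore] -/
theorem nearUniform_threshold_le_log {γ c ε δ A : ℝ} (hγ : 0 < γ) (hc : 0 < c) (hε : 0 < ε) (hε1 : ε ≤ 1) (hγε : γ * ε ≤ 1)
    (hδ : 0 < δ) (hA : 0 < A) :
    2 * ε + Real.log ((A * Real.sqrt (48 * (366 * |(γ * ε)⁻¹ / 2| + 3) / (c * ε))) / δ) / (2 * c) ≤
      2 + (Real.log (A / δ) + Real.log (8928 / (γ * c)) / 2) / (2 * c) + Real.log (1 / ε) / (2 * c) := by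
  have hγε0 : 0 < γ * ε := mul_pos hγ hε
  have habs : |(γ * ε)⁻¹ / 2| = (γ * ε)⁻¹ / 2 := abs_of_pos (by positivity)
  -- the quantity under the root is at most `8928/(γ c ε²)`
  have hγ0 : γ ≠ 0 := hγ.ne'
  have hc0 : c ≠ 0 := hc.ne'
  have hε0 : ε ≠ 0 := hε.ne'
  have hin : 48 * (366 * |(γ * ε)⁻¹ / 2| + 3) / (c * ε) ≤ 8928 / (γ * c) / ε ^ 2 := by
    rw [habs]
    have e1 : 48 * (366 * ((γ * ε)⁻¹ / 2) + 3) / (c * ε) = 48 * (183 + 3 * (γ * ε)) / (γ * c * ε ^ 2) := by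
      field_simp
      ring
    have e2 : 8928 / (γ * c) / ε ^ 2 = 48 * 186 / (γ * c * ε ^ 2) := by
      rw [div_div]
      norm_num
    rw [e1, e2]
    apply div_le_div_of_nonneg_right _ (by positivity)
    nlinarith [hγε]
  have hsq : Real.sqrt (48 * (366 * |(γ * ε)⁻¹ / 2| + 3) / (c * ε)) ≤ Real.sqrt (8928 / (γ * c)) / ε := by
    calc Real.sqrt (48 * (366 * |(γ * ε)⁻¹ / 2| + 3) / (c * ε)) ≤ Real.sqrt (8928 / (γ * c) / ε ^ 2) := Real.sqrt_le_sqrt hin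
      _ = Real.sqrt (8928 / (γ * c)) / ε := by rw [Real.sqrt_div' _ (by positivity), Real.sqrt_sq hε.le]
  have hpos1 : 0 < A * Real.sqrt (48 * (366 * |(γ * ε)⁻¹ / 2| + 3) / (c * ε)) := by
    rw [habs]; positivity
  have hpos2 : 0 < Real.sqrt (8928 / (γ * c)) := Real.sqrt_pos.2 (by positivity)
  -- compare the logarithms
  have hlog : Real.log ((A * Real.sqrt (48 * (366 * |(γ * ε)⁻¹ / 2| + 3) / (c * ε))) / δ) ≤
      Real.log (A / δ) + Real.log (8928 / (γ * c)) / 2 + Real.log (1 / ε) := by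
    have h1 : Real.log ((A * Real.sqrt (48 * (366 * |(γ * ε)⁻¹ / 2| + 3) / (c * ε))) / δ) ≤ Real.log ((A * (Real.sqrt (8928 / (γ * c)) / ε)) / δ) :=
      Real.log_le_log (div_pos hpos1 hδ) (div_le_div_of_nonneg_right (mul_le_mul_of_nonneg_left hsq hA.le) hδ.le)
    have e : Real.log ((A * (Real.sqrt (8928 / (γ * c)) / ε)) / δ) = Real.log (A / δ) + Real.log (8928 / (γ * c)) / 2 + Real.log (1 / ε) := by
      have e1 : (A * (Real.sqrt (8928 / (γ * c)) / ε)) / δ = (A / δ) * Real.sqrt (8928 / (γ * c)) * (1 / ε) := by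
        field_simp
      rw [e1, Real.log_mul (by positivity) (by positivity), Real.log_mul (by positivity) hpos2.ne', Real.log_sqrt (by positivity)]
    linarith
  have h2c : 0 < 2 * c := by positivity
  have hdiv := div_le_div_of_nonneg_right hlog h2c.le
  have e3 : (Real.log (A / δ) + Real.log (8928 / (γ * c)) / 2 + Real.log (1 / ε)) / (2 * c) =
      (Real.log (A / δ) + Real.log (8928 / (γ * c)) / 2) / (2 * c) + Real.log (1 / ε) / (2 * c) := by ring
  rw [e3] at hdiv
  linarith

end Summit.QuantumFields.YangMills.Theorems.ColdStartUniversality
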